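import Summits.ValiantsHypothesis.ValiantsHypothesis.Theorems.BarrierLeverAnchoredDoorHitsLowerPairsLTRest
import Mathlib.Data.Fin.Tuple.Sort

/-!
# Support item `AnchoredDoorHitsLowerPairs` (stmt-ValiantsHypothesis-22510), line `anchored-peeling`:
# LT CERTIFICATES IN KEY FORM — a designated-row bijection plus an injective key that decreases along supports gives `LTCert`

Helper file (`--supports stmt-ValiantsHypothesis-22510`; cell valiant-natproofs, rung V4, 𝒟-side door (c); registered line
`Cruxes/AnchoredDoorHitsLowerPairs/Lines/anchored_peeling.lean` v19 (registered residual `Stmt.stub_ltRest`; offered node `Stmt.stub_decrementFamily`, p650456);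
prover seat val-np-p1 gen 22; memo HOME/val-np-p1/g22/MEMO-relapex-valnp1-g22.md §14–§15). Closes NO item.

WHY. The paper proof that the DECREMENT CERTIFICATE is an LT certificate for the canonical residual family `(R_a, K_{2^a−1})` for EVERY `a` (memo §15) has the
shape: an explicit bijection `d` (column ↦ designated row, with `d(c) ∈ Supp(c)`) and an explicit injective KEY on columns such that every support row of a
column is the designated row of a column with smaller-or-equal key. This file turns that shape into `LTCert` once and for all (`ltCert_of_key`): sort the
columns by the key (`Tuple.sort`) and read off the triangular order required by `LTCert` / `det_doorLayout_ne_zero_of_ltCert` (p634984). The general-`k`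
formalisation of memo §15 then only has to supply `B, T, d, κ` and the two combinatorial facts; per-`a` instances are already in the tree (`…DecrementCertificate`).

* `ltCert_of_key` and the profile-1 corollary `symbolicDet_one_ne_zero_of_key`.

WHAT THIS IS NOT: bookkeeping (no new mathematics); nothing on crux stmt-ValiantsHypothesis-14610 or on `VP` versus `VNP`.
-/

set_option linter.dupNamespace false

namespace Summit.ValiantsHypothesis.ValiantsHypothesis.Theorems.BarrierLever.AnchoredPeeling

variable {h : ℕ}

/-- **LT certificate in key form.** Support data `B, T`; a bijection `d` assigning to each column `j` its designated row `d j`, lying in the column's support;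
an injective key `κ` on columns such that whenever the designated row of `j'` lies in the support of column `j`, then `κ j' ≤ κ j`. Then `LTCert u w`. -/
theorem ltCert_of_key {r : ℕ} (u w : Fin r → Finset (Fin h)) (B : Fin h → Finset (Fin h)) (T : Fin h → Fin h → Finset (Fin h))
    (d : Equiv.Perm (Fin r)) (κ : Fin r → ℕ) (hκ : Function.Injective κ)
    (hdiag : ∀ j, DoorSupp B T (w j) (u (d j)))
    (hkey : ∀ j j', DoorSupp B T (w j) (u (d j')) → κ j' ≤ κ j) : LTCert u w := by
  classical
  -- sort the columns by the key
  set s : Equiv.Perm (Fin r) := Tuple.sort κ with hs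
  have hmono : Monotone (κ ∘ s) := Tuple.monotone_sort κ
  have hstrict : StrictMono (κ ∘ s) :=
    hmono.strictMono_of_injective (hκ.comp s.injective)
  refine ⟨B, T, s.trans d, s, fun i => ?_, fun i j hij hsupp => ?_⟩
  · -- diagonal: column s i against its designated row d (s i)
    simpa [Equiv.trans_apply] using hdiag (s i)
  · -- below the diagonal: row d (s i) in the support of column s j with j < i contradicts the key order
    have hle : κ (s i) ≤ κ (s j) := by
      have := hkey (s j) (s i) (by simpa [Equiv.trans_apply] using hsupp)
      exact this
    have hlt : κ (s j) < κ (s i) := hstrict hij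
    omega

/-- **Key-form certificate ⟹ profile-1 hit.** -/
theorem symbolicDet_one_ne_zero_of_key {r : ℕ} (u w : Fin r → Finset (Fin h)) (B : Fin h → Finset (Fin h)) (T : Fin h → Fin h → Finset (Fin h))
    (d : Equiv.Perm (Fin r)) (κ : Fin r → ℕ) (hκ : Function.Injective κ)
    (hdiag : ∀ j, DoorSupp B T (w j) (u (d j)))
    (hkey : ∀ j j', DoorSupp B T (w j) (u (d j')) → κ j' ≤ κ j) : symbolicDet 1 h r u w ≠ 0 :=
  symbolicDet_one_ne_zero_of_ltCert u w (ltCert_of_key u w B T d κ hκ hdiag hkey)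

end Summit.ValiantsHypothesis.ValiantsHypothesis.Theorems.BarrierLever.AnchoredPeeling
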